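import Summits.AtomisticToContinuum.HydrodynamicLimit.Theses.SuperextensiveClosureCost
import Summits.AtomisticToContinuum.HydrodynamicLimit.Theorems.SuperextensiveClosureCostBlockEntropyBudgetBallAverages
import Literature.Analysis.FluidPDE.ReleaseLogBoundDatum
import Literature.Analysis.FluidPDE.HardSpherePhaseSpaceProofs
import Literature.MathematicalPhysics.KineticTheory.HardSphereCanonicalTorus
import Literature.MathematicalPhysics.KineticTheory.HardSphereEulerProofs
import HarnessLib

/-!
# Component (ii) of the crux `AprioriBounds` from `SuperextensiveClosureCost.NoDenseInclusions`
(line `Sketch`, crux `StiffCollisionalRelaxation.AprioriBounds`, stmt-AtomisticToContinuum-14827)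

Helper file (`--supports stmt-AtomisticToContinuum-14827`), stub `ceiling_of_noDenseInclusions`.

Component (ii) of the crux asks, under the prefix "profiles → `∃ σ₀ ∃ η₁ ∀ σ < σ₀` → classical
hs-Euler solution on `[0, T)` → flow family with the `t = 0` LLN → `0 < t < T` with the chamber
`2ρσ³ < η₁` on `[0, t]`", that for every admissible kernel family `φ_N` at mesoscale
`R_N = (N+1)^{-γ}`, `γ ≤ 1/15`, no mesoscopic cell is jammed with high probability:
`P_N{∃ s ≤ t, ∃ x, 1 < ρ̄_φ(s, x) σ³} → 0`, `ρ̄_φ(s, x) = (N+1)⁻¹ ∑ᵢ φ_N(qᵢ(s) − x)`.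

This file docks it to the sibling crux `SuperextensiveClosureCost.NoDenseInclusions`
(stmt-AtomisticToContinuum-14425): for every `η₁ > 0` and profiles `∃ σ₀ ∀ σ < σ₀`, for every
classical solution, flow family with the `t = 0` LLN and `t ∈ [0, T)` with `ρσ³ ≤ η₁/2` on `[0, t]`,
`P_N{∃ r ≤ t, ∃ x, η₁ < ρ^{(ℓ)}(r, x) σ³} → 0`, where `ρ^{(ℓ)}(r, x)` is the FLAT ball average of the
empirical density at the finer block scale `ℓ_N = (N+1)^{-1/4}` (`≤ R_N` iff `γ ≤ 1/4`).

The glue (`ceiling_of_noDenseInclusions`):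
* level: `η₁ := 1/2` in both; our chamber `2ρσ³ < 1/2` is the item's `ρσ³ ≤ 1/4 = η₁/2`;
* DETERMINISTIC COMPARISON (`ceilingNDI_config`): for every configuration whose flat ball averages
  at scale `ℓ` are all `≤ M`, every `φ(· − x)`-average is `≤ M (1 + ε)`,
  `ε = √3 L ℓ (4/3)π(R + ℓ)³` (`‖∇φ‖ ≤ L`, `φ = 0` off `{dist(·,0) < R}`, `∫φ = 1`, `R + ℓ < 1/2`):
  each kernel value `φ(q − x)` is below the `ℓ`-ball average around `q` of the majorant
  `φ(· − x) + √3 L ℓ 𝟙{dist(·, x) < R + ℓ}` (mean value inequality on the torus,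
  `Torus.abs_sub_le_of_norm_gradient_le`, `‖·‖_∞ ≤ dist`, triangle inequality, support clause);
  summing over particles and exchanging sum and integral bounds `ρ̄_φ(x)` by
  `∫ majorant · ρ^{(ℓ)} ≤ M ∫ majorant = M (1 + ε)` (translation invariance of the Haar measure of
  `𝕋³` and the Euclidean volume of a small minimal-image ball, `volume_setOf_euclidDist_lt_T3`);
* RATE (`ceilingNDI_rate`): with `L = C (N+1)^{4γ}`, `ε_N = √3 C (4/3)π u_N (1 + u_N)³ → 0`,
  `u_N = (N+1)^{γ − 1/4}`, since `γ ≤ 1/15 < 1/4`;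
* events: for `N` with `ε_N < 1` and `R_N + ℓ_N < 1/2`, on `{∀ x', ρ^{(ℓ)}(s, x') σ³ ≤ 1/2}` one
  has `ρ̄_φ(s, x) σ³ ≤ (1/2)(1 + ε_N) < 1`, so our bad event lies in the item's; `measure_mono` and
  an eventual squeeze.

No new definitions, no named facts; axioms `propext`, `Classical.choice`, `Quot.sound`.
-/

noncomputable section

open MeasureTheory Filter Set Topology
open scoped ENNReal

namespace Summit.AtomisticToContinuum.HydrodynamicLimit.Theorems.AdiabatCeiling

open Literature.MathematicalPhysics.KineticTheory Literature.Analysis.FluidPDE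

/-! ## The deterministic comparison: a smooth kernel at scale `R` against flat ball averages at
scale `ℓ` -/

/-- **Pointwise majorant.** For a smooth `h ≥ 0` on `𝕋³` with `‖∇h‖ ≤ L` vanishing on
`{dist(·, 0) ≥ R}`, every `x`, every particle position `q` and every point `w'` of the
minimal-image ball `{dist(w', q) < ℓ}`:
`h(q − x) ≤ h(w' − x) + √3 L ℓ · 𝟙{dist(w', x) < R + ℓ}` — the mean value inequality on the torus
with `‖q − w'‖_∞ ≤ dist(q, w') < ℓ` when `dist(q, x) < R` (then `dist(w', x) < ℓ + R` by the
triangle inequality), and the support clause otherwise. [folklore] -/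
private theorem ceilingNDI_pointwise {h : T3 → ℝ}
    (hh : Literature.Analysis.FunctionSpaces.Torus.IsSmooth h) {L R ℓ : ℝ}
    (hL : ∀ y, ‖Literature.Analysis.FunctionSpaces.Torus.gradient h y‖ ≤ L) (h0 : ∀ y, 0 ≤ h y)
    (hsupp : ∀ y, R ≤ Torus.euclidDist y 0 → h y = 0) (x q w' : T3)
    (hw' : Torus.euclidDist w' q < ℓ) :
    h (q - x) ≤ h (w' - x) +
      (if Torus.euclidDist w' x < R + ℓ then Real.sqrt 3 * L * ℓ else 0) := by
  have hL0 : 0 ≤ L := (norm_nonneg _).trans (hL x)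
  have hd0 : 0 ≤ Torus.euclidDist w' q := norm_nonneg _
  have hℓ0 : 0 ≤ ℓ := hd0.trans hw'.le
  have hK : 0 ≤ Real.sqrt 3 * L * ℓ := by positivity
  by_cases hq : R ≤ Torus.euclidDist (q - x) 0
  · rw [hsupp _ hq]
    refine add_nonneg (h0 _) ?_
    split_ifs
    · exact hK
    · exact le_rfl
  · push Not at hq
    have hqx : Torus.euclidDist (q - x) 0 = Torus.euclidDist q x := by
      rw [Torus.euclidDist_eq, Torus.euclidDist_eq, sub_zero]
    rw [hqx] at hq
    have hball : Torus.euclidDist w' x < R + ℓ := by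
      calc Torus.euclidDist w' x ≤ Torus.euclidDist w' q + Torus.euclidDist q x :=
            euclidDist_triangle w' q x
        _ < ℓ + R := add_lt_add hw' hq
        _ = R + ℓ := add_comm _ _
    rw [if_pos hball]
    have hmv := Literature.Analysis.FluidPDE.Torus.abs_sub_le_of_norm_gradient_le hh hL (q - x) (w' - x)
    have hcard : Real.sqrt (Fintype.card (Fin 3)) = Real.sqrt 3 := by norm_num
    rw [hcard, sub_sub_sub_cancel_right] at hmv
    have hnorm : ‖q - w'‖ ≤ ℓ := by
      refine (Literature.Analysis.FluidPDE.Torus.norm_sub_le_euclidDist_holds q w').trans ?_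
      rw [Torus.euclidDist_comm]
      exact hw'.le
    calc h (q - x) ≤ h (w' - x) + |h (q - x) - h (w' - x)| := by
          linarith [le_abs_self (h (q - x) - h (w' - x))]
      _ ≤ h (w' - x) + Real.sqrt 3 * L * ‖q - w'‖ := by linarith
      _ ≤ h (w' - x) + Real.sqrt 3 * L * ℓ := by gcongr

/-- **One particle: the kernel value is below a ball average of the majorant.** With
`b = ((4/3)πℓ³)⁻¹` and `0 < ℓ < 1/2` (so that `∫ 𝟙{dist(w', q) < ℓ} b dw' = 1`):
`h(q − x) ≤ ∫ (h(w' − x) + √3 L ℓ 𝟙{dist(w', x) < R + ℓ}) · 𝟙{dist(w', q) < ℓ} b dw'`. [folklore] -/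
private theorem ceilingNDI_particle {h : T3 → ℝ}
    (hh : Literature.Analysis.FunctionSpaces.Torus.IsSmooth h) {L R ℓ : ℝ}
    (hL : ∀ y, ‖Literature.Analysis.FunctionSpaces.Torus.gradient h y‖ ≤ L) (h0 : ∀ y, 0 ≤ h y)
    (hsupp : ∀ y, R ≤ Torus.euclidDist y 0 → h y = 0) (hℓ0 : 0 < ℓ) (hℓ : ℓ < 1 / 2)
    (x q : T3) :
    h (q - x) ≤ ∫ w' : T3, (h (w' - x) +
        (if Torus.euclidDist w' x < R + ℓ then Real.sqrt 3 * L * ℓ else 0)) *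
      (if Torus.euclidDist w' q < ℓ then (4 / 3 * Real.pi * ℓ ^ 3)⁻¹ else 0) := by
  have hb : (0 : ℝ) < (4 / 3 * Real.pi * ℓ ^ 3)⁻¹ := by positivity
  -- integrability of the majorant and of its product with the ball kernel
  have hg : Integrable fun w' : T3 => h (w' - x) +
      (if Torus.euclidDist w' x < R + ℓ then Real.sqrt 3 * L * ℓ else 0) :=
    ((hh.continuous.comp (continuous_sub_right x)).integrable_of_hasCompactSupport
      (HasCompactSupport.of_compactSpace _)).add (integrable_ballKernel (R + ℓ) _ x)
  have hgk : Integrable fun w' : T3 => (h (w' - x) +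
      (if Torus.euclidDist w' x < R + ℓ then Real.sqrt 3 * L * ℓ else 0)) *
      (if Torus.euclidDist w' q < ℓ then (4 / 3 * Real.pi * ℓ ^ 3)⁻¹ else 0) := by
    refine hg.mul_bdd (integrable_ballKernel ℓ _ q).aestronglyMeasurable
      (ae_of_all _ fun w' => (?_ : _ ≤ (4 / 3 * Real.pi * ℓ ^ 3)⁻¹))
    split_ifs
    · rw [Real.norm_eq_abs, abs_of_pos hb]
    · rw [norm_zero]; exact hb.le
  calc h (q - x) = ∫ w' : T3, h (q - x) *
        (if Torus.euclidDist w' q < ℓ then (4 / 3 * Real.pi * ℓ ^ 3)⁻¹ else 0) := by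
        rw [integral_const_mul, integral_ballKernel_eq_one hℓ0 hℓ q, mul_one]
    _ ≤ _ := by
        refine integral_mono ((integrable_ballKernel ℓ _ q).const_mul _) hgk fun w' => ?_
        by_cases hw' : Torus.euclidDist w' q < ℓ
        · simp only [if_pos hw']
          exact mul_le_mul_of_nonneg_right (ceilingNDI_pointwise hh hL h0 hsupp x q w' hw') hb.le
        · simp only [if_neg hw', mul_zero, le_refl]

/-- **The deterministic comparison.** For a configuration `w` of `n` particles on `𝕋³`, if every
flat ball average at scale `ℓ` is at most `M`,
`n⁻¹ ∑ᵢ 𝟙{dist(x', qᵢ) < ℓ} / ((4/3)πℓ³) ≤ M` for all centres `x'`, then the `h(· − x)`-average is at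
most `M (1 + √3 L ℓ (4/3)π(R + ℓ)³)` for every `x` (`h ≥ 0` smooth, `∫ h = 1`, `‖∇h‖ ≤ L`, `h = 0`
off `{dist(·, 0) < R}`, `0 < ℓ`, `0 ≤ R`, `R + ℓ < 1/2`): sum the one-particle bound over the
particles, exchange sum and integral, bound the ball average of the configuration by `M`, and
integrate the majorant (translation invariance of the Haar measure and the Euclidean volume of a
small minimal-image ball). [folklore] -/
private theorem ceilingNDI_config {h : T3 → ℝ}
    (hh : Literature.Analysis.FunctionSpaces.Torus.IsSmooth h) {L R ℓ M : ℝ}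
    (hL : ∀ y, ‖Literature.Analysis.FunctionSpaces.Torus.gradient h y‖ ≤ L) (h0 : ∀ y, 0 ≤ h y)
    (hmass : ∫ y, h y = 1) (hsupp : ∀ y, R ≤ Torus.euclidDist y 0 → h y = 0) (hℓ0 : 0 < ℓ)
    (hR0 : 0 ≤ R) (hRℓ : R + ℓ < 1 / 2) {n : ℕ} (w : Config n (Fin 3) T3)
    (hM : ∀ x' : T3, empiricalDensityField w
      (fun y => if Torus.euclidDist x' y < ℓ then (4 / 3 * Real.pi * ℓ ^ 3)⁻¹ else 0) ≤ M)
    (x : T3) :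
    empiricalDensityField w (fun y => h (y - x)) ≤
      M * (1 + Real.sqrt 3 * L * ℓ * (4 / 3 * Real.pi * (R + ℓ) ^ 3)) := by
  have hℓ : ℓ < 1 / 2 := by linarith
  have hL0 : 0 ≤ L := (norm_nonneg _).trans (hL x)
  have hK : 0 ≤ Real.sqrt 3 * L * ℓ := by positivity
  -- the majorant `g`, its sign, integrability and integral
  have hg0 : ∀ w' : T3, 0 ≤ h (w' - x) +
      (if Torus.euclidDist w' x < R + ℓ then Real.sqrt 3 * L * ℓ else 0) := fun w' => by
    refine add_nonneg (h0 _) ?_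
    split_ifs
    · exact hK
    · exact le_rfl
  have hg1 : Integrable fun w' : T3 => h (w' - x) :=
    (hh.continuous.comp (continuous_sub_right x)).integrable_of_hasCompactSupport
      (HasCompactSupport.of_compactSpace _)
  have hg2 : Integrable fun w' : T3 =>
      (if Torus.euclidDist w' x < R + ℓ then Real.sqrt 3 * L * ℓ else 0) :=
    integrable_ballKernel (R + ℓ) _ x
  have hg : Integrable fun w' : T3 => h (w' - x) +
      (if Torus.euclidDist w' x < R + ℓ then Real.sqrt 3 * L * ℓ else 0) := hg1.add hg2
  have hgint : ∫ w' : T3, (h (w' - x) +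
      (if Torus.euclidDist w' x < R + ℓ then Real.sqrt 3 * L * ℓ else 0)) =
      1 + Real.sqrt 3 * L * ℓ * (4 / 3 * Real.pi * (R + ℓ) ^ 3) := by
    have hV : (0 : ℝ) ≤ 4 / 3 * Real.pi * (R + ℓ) ^ 3 := by positivity
    rw [integral_add hg1 hg2, integral_sub_right_eq_self (fun y => h y) x, hmass,
      ballKernel_eq_indicator, integral_indicator (measurableSet_setOf_euclidDist_lt _ x),
      setIntegral_const, smul_eq_mul, measureReal_def,
      volume_setOf_euclidDist_lt_T3 (by positivity) hRℓ x, ENNReal.toReal_ofReal hV, mul_comm]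
  -- integrability of `g ·` ball kernel at any centre
  have hb : (0 : ℝ) < (4 / 3 * Real.pi * ℓ ^ 3)⁻¹ := by positivity
  have hgk : ∀ q : T3, Integrable fun w' : T3 => (h (w' - x) +
      (if Torus.euclidDist w' x < R + ℓ then Real.sqrt 3 * L * ℓ else 0)) *
      (if Torus.euclidDist w' q < ℓ then (4 / 3 * Real.pi * ℓ ^ 3)⁻¹ else 0) := fun q => by
    refine hg.mul_bdd (integrable_ballKernel ℓ _ q).aestronglyMeasurable
      (ae_of_all _ fun w' => (?_ : _ ≤ (4 / 3 * Real.pi * ℓ ^ 3)⁻¹))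
    split_ifs
    · rw [Real.norm_eq_abs, abs_of_pos hb]
    · rw [norm_zero]; exact hb.le
  rw [empiricalDensityField_eq_sum]
  calc (n : ℝ)⁻¹ * ∑ i, h ((w i).1 - x)
      ≤ (n : ℝ)⁻¹ * ∑ i, ∫ w' : T3, (h (w' - x) +
          (if Torus.euclidDist w' x < R + ℓ then Real.sqrt 3 * L * ℓ else 0)) *
          (if Torus.euclidDist w' (w i).1 < ℓ then (4 / 3 * Real.pi * ℓ ^ 3)⁻¹ else 0) := by
        gcongr with i
        exact ceilingNDI_particle hh hL h0 hsupp hℓ0 hℓ x (w i).1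
    _ = ∫ w' : T3, (n : ℝ)⁻¹ * ∑ i, (h (w' - x) +
          (if Torus.euclidDist w' x < R + ℓ then Real.sqrt 3 * L * ℓ else 0)) *
          (if Torus.euclidDist w' (w i).1 < ℓ then (4 / 3 * Real.pi * ℓ ^ 3)⁻¹ else 0) := by
        rw [integral_const_mul, integral_finsetSum _ fun i _ => hgk (w i).1]
    _ ≤ ∫ w' : T3, (h (w' - x) +
          (if Torus.euclidDist w' x < R + ℓ then Real.sqrt 3 * L * ℓ else 0)) * M := by
        refine integral_mono ((integrable_finsetSum _ fun i _ => hgk (w i).1).const_mul _)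
          (hg.mul_const M) fun w' => ?_
        have hF := hM w'
        rw [empiricalDensityField_eq_sum] at hF
        dsimp only
        rw [← Finset.mul_sum, mul_left_comm]
        exact mul_le_mul_of_nonneg_left hF (hg0 w')
    _ = M * (1 + Real.sqrt 3 * L * ℓ * (4 / 3 * Real.pi * (R + ℓ) ^ 3)) := by
        rw [integral_mul_const, hgint, mul_comm]

/-! ## The rate `ε_N → 0` and the scales -/

/-- `x^{4γ} · (x^{-γ})⁴ = 1` for `x > 0`. [folklore] -/
private theorem ceilingNDI_rpow_four_mul_mul_fourth {x : ℝ} (hx : 0 < x) (γ : ℝ) :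
    x ^ (4 * γ) * (x ^ (-γ)) ^ 4 = 1 := by
  -- adapted from Theorems/StiffCollisionalRelaxationAprioriBoundsPartTwoOfKineticRangeControl.lean
  have h4 : (x ^ (-γ)) ^ 4 = x ^ (-γ * 4) := by rw [Real.rpow_mul hx.le, Real.rpow_ofNat]
  rw [h4, ← Real.rpow_add hx, show 4 * γ + -γ * 4 = 0 by ring, Real.rpow_zero]

/-- **The rate.** `ε_N = √3 C (N+1)^{4γ} ℓ_N (4/3)π(R_N + ℓ_N)³ → 0` for `ℓ_N = (N+1)^{-1/4}`,
`R_N = (N+1)^{-γ}`, `0 < γ < 1/4`: with `u_N = (N+1)^{γ - 1/4} → 0` one has `ℓ_N = R_N u_N` and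
`ε_N = √3 C (4/3)π · u_N (1 + u_N)³`. [folklore] -/
private theorem ceilingNDI_rate {γ : ℝ} (hγ4 : γ < 1 / 4) (C : ℝ) :
    Tendsto (fun N : ℕ => Real.sqrt 3 * (C * ((N : ℝ) + 1) ^ (4 * γ)) *
        ((N + 1 : ℕ) : ℝ) ^ (-(1 / 4 : ℝ)) *
        (4 / 3 * Real.pi * (((N : ℝ) + 1) ^ (-γ) + ((N + 1 : ℕ) : ℝ) ^ (-(1 / 4 : ℝ))) ^ 3))
      atTop (𝓝 0) := by
  have hu : Tendsto (fun N : ℕ => ((N : ℝ) + 1) ^ (-(1 / 4 - γ))) atTop (𝓝 0) :=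
    (tendsto_rpow_neg_atTop (by linarith)).comp
      (tendsto_natCast_atTop_atTop.atTop_add tendsto_const_nhds)
  have hlim : Tendsto (fun N : ℕ => Real.sqrt 3 * C * (4 / 3 * Real.pi) *
      (((N : ℝ) + 1) ^ (-(1 / 4 - γ)) * (1 + ((N : ℝ) + 1) ^ (-(1 / 4 - γ))) ^ 3)) atTop (𝓝 0) := by
    have h := (hu.mul ((tendsto_const_nhds (x := (1 : ℝ))).add hu |>.pow 3)).const_mul
      (Real.sqrt 3 * C * (4 / 3 * Real.pi))
    simpa using h
  refine (tendsto_congr fun N => ?_).2 hlim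
  have hx : 0 < (N : ℝ) + 1 := by positivity
  have hcast : ((N + 1 : ℕ) : ℝ) = (N : ℝ) + 1 := by push_cast; ring
  have hℓ : ((N : ℝ) + 1) ^ (-(1 / 4 : ℝ)) = ((N : ℝ) + 1) ^ (-γ) * ((N : ℝ) + 1) ^ (-(1 / 4 - γ)) := by
    rw [← Real.rpow_add hx]
    congr 1
    ring
  have hid := ceilingNDI_rpow_four_mul_mul_fourth hx γ
  rw [hcast, hℓ]
  linear_combination (Real.sqrt 3 * C * (4 / 3 * Real.pi) *
    (((N : ℝ) + 1) ^ (-(1 / 4 - γ)) * (1 + ((N : ℝ) + 1) ^ (-(1 / 4 - γ))) ^ 3)) * hid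

/-- The two scales vanish: `R_N + ℓ_N = (N+1)^{-γ} + (N+1)^{-1/4} → 0` for `γ > 0`. [folklore] -/
private theorem ceilingNDI_scales {γ : ℝ} (hγ : 0 < γ) :
    Tendsto (fun N : ℕ => ((N : ℝ) + 1) ^ (-γ) + ((N + 1 : ℕ) : ℝ) ^ (-(1 / 4 : ℝ))) atTop (𝓝 0) := by
  have hR : Tendsto (fun N : ℕ => ((N : ℝ) + 1) ^ (-γ)) atTop (𝓝 0) :=
    (tendsto_rpow_neg_atTop hγ).comp (tendsto_natCast_atTop_atTop.atTop_add tendsto_const_nhds)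
  have hℓ : Tendsto (fun N : ℕ => ((N + 1 : ℕ) : ℝ) ^ (-(1 / 4 : ℝ))) atTop (𝓝 0) :=
    (tendsto_rpow_neg_atTop (by norm_num)).comp
      (tendsto_natCast_atTop_atTop.comp (tendsto_add_atTop_nat 1))
  simpa using hR.add hℓ

/-! ## Component (ii) from stmt-14425 -/

/-- **Component (ii) of `AprioriBounds` from `NoDenseInclusions` (stmt-14425).** The crux
`SuperextensiveClosureCost.NoDenseInclusions` (no dense inclusions at the block scale
`ℓ_N = (N+1)^{-1/4}` before the shock, in local-Gibbs probability, while the classical solution has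
`ρσ³ ≤ η₁/2`) implies the ceiling half of component (ii) of the crux
`StiffCollisionalRelaxation.AprioriBounds` with `η₁ := 1/2` and the item's `σ₀` at its `η₁ := 1/2`:
our chamber `2ρσ³ < 1/2` on `[0, t]` gives the item's `ρσ³ ≤ 1/4`; on the complement of the item's
bad event at time `s`, every flat ball average at scale `ℓ_N` is `≤ 1/(2σ³)`, so by the deterministic
comparison `ceilingNDI_config` every `φ_N(· − x)`-average is `≤ (1/(2σ³))(1 + ε_N)` with
`ε_N = √3 C (N+1)^{4γ} ℓ_N (4/3)π(R_N + ℓ_N)³ → 0` (`ceilingNDI_rate`, `γ ≤ 1/15 < 1/4`), hence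
`< 1/σ³` once `ε_N < 1`; so eventually our bad event lies in the item's, and the item's probability
tends to `0`. -/
theorem ceiling_of_noDenseInclusions : Summit.AtomisticToContinuum.HydrodynamicLimit.Theses.SuperextensiveClosureCost.NoDenseInclusions → ∀ (a₀ θ₀ : T3 → ℝ) (u₀ : T3 → V3), Continuous a₀ → Continuous θ₀ → Continuous u₀ → (∀ x, 0 < a₀ x) → (∀ x, 0 < θ₀ x) → ∃ σ₀ : ℝ, 0 < σ₀ ∧ ∃ η₁ : ℝ, 0 < η₁ ∧ ∀ σ : ℝ, 0 < σ → σ < σ₀ → ∀ (T : ℝ) (ρ θ : ℝ → T3 → ℝ) (u : ℝ → T3 → V3), IsHardSphereEulerSolution σ T ρ u θ → ∀ Φ : (N : ℕ) → HardSphereFlow (Torus.geometry (Fin 3)) (hsDiameter σ N) (N + 1), TendstoHydroFieldsAt (fun N => localGibbsLaw σ a₀ u₀ θ₀ N (Φ N)) Φ ρ u θ 0 → ∀ t : ℝ, 0 < t → t < T → (∀ s ∈ Icc 0 t, ∀ x, 2 * ρ s x * σ ^ 3 < η₁) → ∀ (γ C : ℝ) (φ : ℕ → T3 → ℝ), 0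 < γ → γ ≤ 1 / 15 → ((∀ N, Literature.Analysis.FunctionSpaces.Torus.IsSmooth (φ N)) ∧ (∀ N y, 0 ≤ φ N y) ∧ (∀ N, ∫ y, φ N y = 1) ∧ (∀ (N : ℕ) y, ((N : ℝ) + 1) ^ (-γ) ≤ Torus.euclidDist y 0 → φ N y = 0) ∧ (∀ (N : ℕ) y, φ N y ≤ C * ((N : ℝ) + 1) ^ (3 * γ)) ∧ (∀ (N : ℕ) y, ‖Literature.Analysis.FunctionSpaces.Torus.gradient (φ N) y‖ ≤ C * ((N : ℝ) + 1) ^ (4 * γ))) → Tendsto (fun N : ℕ => localGibbsLaw σ a₀ u₀ θ₀ N (Φ N) {z | ∃ s ∈ Icc 0 t, ∃ x : T3, 1 < empiricalDensityField ((Φ N).flow s z) (fun y => φ N (y - x)) * σ ^ 3}) atTop (𝓝 0) := by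
  intro hNDI a₀ θ₀ u₀ ha hθ hu ha0 hθ0
  -- the item at level `η₁ := 1/2`
  obtain ⟨σ₀, hσ₀, H⟩ := hNDI (1 / 2) one_half_pos a₀ θ₀ u₀ ha hθ hu ha0 hθ0
  refine ⟨σ₀, hσ₀, 1 / 2, one_half_pos,
    fun σ hσ hσlt T ρ θ u hE Φ hL t ht htT hch γ C φ hγ hγ' hφ => ?_⟩
  obtain ⟨hsm, hnn, hmass, hsupp, -, hgrad⟩ := hφ
  -- our chamber `2ρσ³ < 1/2` on `[0, t]` is the item's `ρσ³ ≤ (1/2)/2`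
  have hch' : ∀ r ∈ Icc 0 t, ∀ x, ρ r x * σ ^ 3 ≤ 1 / 2 / 2 := fun r hr x => by
    have h := hch r hr x
    linarith
  have hT := H σ hσ hσlt T ρ θ u hE Φ hL t ⟨ht.le, htT⟩ hch'
  -- eventually `ε_N < 1` and `R_N + ℓ_N < 1/2`
  have hev := ((ceilingNDI_rate (by linarith : γ < 1 / 4) C).eventually
    (eventually_lt_nhds one_pos)).and
    ((ceilingNDI_scales hγ).eventually (eventually_lt_nhds one_half_pos))
  refine tendsto_of_tendsto_of_tendsto_of_le_of_le' tendsto_const_nhds hT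
    (Eventually.of_forall fun N => bot_le) ?_
  filter_upwards [hev] with N hN
  refine measure_mono ?_
  rintro z ⟨s, hs, x, hx⟩
  simp only [Set.mem_setOf_eq]
  refine ⟨s, hs, ?_⟩
  by_contra hcon
  push Not at hcon
  have hσ3 : 0 < σ ^ 3 := pow_pos hσ 3
  have hℓ0 : 0 < ((N + 1 : ℕ) : ℝ) ^ (-(1 / 4 : ℝ)) := blockScale_pos N
  have hR0 : 0 ≤ ((N : ℝ) + 1) ^ (-γ) := (Real.rpow_pos_of_pos (by positivity) _).le
  have hM : ∀ x' : T3, empiricalDensityField ((Φ N).flow s z)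
      (fun y => if Torus.euclidDist x' y < ((N + 1 : ℕ) : ℝ) ^ (-(1 / 4 : ℝ)) then
        (4 / 3 * Real.pi * (((N + 1 : ℕ) : ℝ) ^ (-(1 / 4 : ℝ))) ^ 3)⁻¹ else 0) ≤ 1 / 2 / σ ^ 3 :=
    fun x' => (le_div_iff₀ hσ3).2 (hcon x')
  have hkey := ceilingNDI_config (hsm N) (hgrad N) (hnn N) (hmass N) (hsupp N) hℓ0 hR0 hN.2
    ((Φ N).flow s z) hM x
  have hkey' : empiricalDensityField ((Φ N).flow s z) (fun y => φ N (y - x)) * σ ^ 3 ≤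
      1 / 2 * (1 + Real.sqrt 3 * (C * ((N : ℝ) + 1) ^ (4 * γ)) *
        ((N + 1 : ℕ) : ℝ) ^ (-(1 / 4 : ℝ)) *
        (4 / 3 * Real.pi * (((N : ℝ) + 1) ^ (-γ) + ((N + 1 : ℕ) : ℝ) ^ (-(1 / 4 : ℝ))) ^ 3)) := by
    have h := mul_le_mul_of_nonneg_right hkey hσ3.le
    rwa [mul_assoc (1 / 2 / σ ^ 3), mul_comm (1 + _) (σ ^ 3), ← mul_assoc,
      div_mul_cancel₀ _ hσ3.ne'] at h
  nlinarith [hN.1]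

end Summit.AtomisticToContinuum.HydrodynamicLimit.Theorems.AdiabatCeiling

end
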